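import Summits.BirchSwinnertonDyer.Rank1Residual.ManinAdditive.CMTwinStevensMinimalNetCount
import Literature.NumberTheory.EllipticCurves.StevensMinimalLatticeConductorLe200
import HarnessLib

/-!
# `StevensGammaOneMinimalAt n` for `n ≤ 200` from Stevens 1989 Thm (7.1) — the 3-line adapter, and the NET COUNTS restated
over the Literature fact (cell `bsd-f2-manin`, es g30 MEMO-es §44.H/§44.I; typer g19, T-es-45 / T-es-47 follow-up)

TYPER NOTE (typer g19).  `…KatoCurve.CMTwinMinimal.StevensGammaOneMinimalAt n` (es g30, `CMTwinStevensMinimalNetCount.lean`,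
p716671) is Stevens' I″ CONTAINMENT `Λ₁(f) ⊆ Λ(V)` for a lattice-minimal `V` of conductor `n`, with the level `N` of the newform
`f` NOT tied to `n`.  The Literature fact `Stevens1989_thm_7_1_gamma1Lattice_conductor_le_200` (p717062;
`Literature/NumberTheory/EllipticCurves/StevensMinimalLatticeConductorLe200.lean`: Stevens 1989 Thm (7.1) p. 104 in the lattice
form (2.9), `Λ₁(f) = Λ(A_min)` for conductor = level `≤ 200`) gives it for every `n ≤ 200` once the level is identified with the
conductor — Carayol's theorem, the tree fact `IsNewformOf.level_eq_conductorNorm` (hypothesis `hN` below, by name, exactly as in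
es's `cmOptimalIsFullCMTwo_of_rerooting`).  Consequences recorded: the net counts of §44.H/§44.I with the print inputs at 32, 64
resp. 27 supplied — **E-es-136₂ ⟸ E-es-137₂ ∧ `CMRootTwistReducedTwo` ∧ E-es-133⁺₂ ∧ Stevens (7.1) ∧ Carayol** and
**E-es-136₃ ⟸ E-es-137₃ ∧ `CMRootTwistReducedThree` ∧ E-es-133⁺₃ ∧ Stevens (7.1) ∧ Carayol**.  Theorem-only file; nothing
conjectured; imports the landed leaf + the Literature fact (ROUTE-INDEPENDENT).  PARTITION 0 · beyond-print theorem: no ·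
bears_on stmt-BirchSwinnertonDyer-22967 / 22968 (CM slices) · BSD is not proved by this; C2, C3 OPEN.
-/

set_option autoImplicit false

noncomputable section

namespace Summit.BirchSwinnertonDyer.Rank1Residual.ManinAdditive.KatoCurve.CMTwinMinimal

open scoped MatrixGroups ModularForm
open CongruenceSubgroup WeierstrassCurve Literature.NumberTheory.EllipticCurves
  Literature.NumberTheory.EllipticCurves.ModularForms

/-- THE ADAPTER: Stevens 1989 Thm (7.1) (Literature fact, lattice form (2.9)) ∧ Carayol (`level = conductor`, tree fact by
name) ⟹ `StevensGammaOneMinimalAt n` for every `n ≤ 200`. [cite: Stevens1989Invent, Thm. (7.1) p. 104] -/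
theorem stevensGammaOneMinimalAt_of_stevens1989
    (hS : Stevens1989_thm_7_1_gamma1Lattice_conductor_le_200)
    (hN : ∀ (N : ℕ) [NeZero N], IsNewformOf.level_eq_conductorNorm (N := N)) {n : ℕ} (hn : n ≤ 200) :
    StevensGammaOneMinimalAt n := by
  intro V _ _ N _ f L hV hf hL hmin z hz
  have hNV : N = V.conductorNorm ℤ := hN N hf
  have h200 : N ≤ 200 := by rw [hNV, hV]; exact hn
  exact hS.periodLatticeGamma1_subset V f L hNV.symm h200 hf hL hmin z hz

/-- **NET COUNT at `p = 2` with the print inputs supplied:** E-es-136₂ `CMRootGammaOneLatticeLawTwoLocal` ⟸ E-es-137₂ ∧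
`CMRootTwistReducedTwo` ∧ E-es-133⁺₂ ∧ Stevens 1989 Thm (7.1) ∧ Carayol. -/
theorem cmRootGammaOneLatticeLawTwoLocal_of_rootPeriodLaw_of_stevens1989
    (h137 : CMRootPeriodLatticeLawTwoLocal) (hred : CMRootTwistReducedTwo) (hmin : CMTwinStevensMinimalTwo)
    (hS : Stevens1989_thm_7_1_gamma1Lattice_conductor_le_200)
    (hN : ∀ (N : ℕ) [NeZero N], IsNewformOf.level_eq_conductorNorm (N := N)) :
    CMRootGammaOneLatticeLawTwoLocal :=
  cmRootGammaOneLatticeLawTwoLocal_of_rootPeriodLaw h137 hred hmin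
    (stevensGammaOneMinimalAt_of_stevens1989 hS hN (by norm_num))
    (stevensGammaOneMinimalAt_of_stevens1989 hS hN (by norm_num))

/-- **NET COUNT at `p = 3` with the print inputs supplied:** E-es-136₃ `CMRootGammaOneLatticeLawThreeLocal` ⟸ E-es-137₃ ∧
`CMRootTwistReducedThree` ∧ E-es-133⁺₃ ∧ Stevens 1989 Thm (7.1) ∧ Carayol. -/
theorem cmRootGammaOneLatticeLawThreeLocal_of_rootPeriodLaw_of_stevens1989
    (h137 : CMRootPeriodLatticeLawThreeLocal) (hred : CMRootTwistReducedThree) (hmin : CMTwinStevensMinimalThree)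
    (hS : Stevens1989_thm_7_1_gamma1Lattice_conductor_le_200)
    (hN : ∀ (N : ℕ) [NeZero N], IsNewformOf.level_eq_conductorNorm (N := N)) :
    CMRootGammaOneLatticeLawThreeLocal :=
  cmRootGammaOneLatticeLawThreeLocal_of_rootPeriodLaw h137 hred hmin
    (stevensGammaOneMinimalAt_of_stevens1989 hS hN (by norm_num))

end Summit.BirchSwinnertonDyer.Rank1Residual.ManinAdditive.KatoCurve.CMTwinMinimal

end
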